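import Summits.CriticalPhenomena.PercolationContinuityZ3.Theorems.PercExchangeRateTransportCriticalCurveRegular
import Summits.CriticalPhenomena.PercolationContinuityZ3.Theorems.PercExchangeRateTransportModelFacts

/-!
# Forward generator G1 `next-rung`, generation 6 — seed `CriticalCurveRegular` (stmt-CriticalPhenomena-16065)

Census sketch of planner-fwd2-rung-CriticalPhenomena-01-g6-0.  Two candidate rungs over the floor
`CriticalCurveRegular` (continuity of the anisotropic critical curve `t ↦ p_c(t)` of bond percolation on
`ℤ²×ℤ`, `0 < p_c < 1`), typed so that the floor is a literal member of each family, and the verdicts: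

* `IsoLedgeNull := LedgeNullLeft univ` — "θ vanishes on the horizontal ledge `{(p, p₃) : p < p₃}` left of the
  isotropic point" (the top edge of the closed sub-isotropic quadrant; the mirror image of generation 5's
  `IsoShelfNull`, which is the right edge).  ON-PATH (`isoLedgeNull_of_percolationContinuityZ3`) but FLAT:
  `isoLedgeNull_of_floor : CriticalCurveRegular → IsoLedgeNull` is PROVED below from the floor, `ModelFacts`
  clause (9), monotonicity of `θ` and the tree facts `0 < p_c(ℤ³) < 1`, `θ_{ℤ³} = 0` below `p_c`
  (the curve passes through the isotropic point, `p₃ ≤ p_c(p₃)`, by continuity of `p_c` at `p₃` and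
  `t ≤ p_c(t)` for `t < p₃`; then the threshold property).  Hence `isoLedgeNull_holds`.  Not a rung.
* `CurveC1 := CurveSmooth 1` — the critical curve is `C¹` on `(0,1)` (Clausius–Clapeyron regularity; family
  `CurveSmooth r`, `r = 0` is the floor by `contDiffOn_zero`).  OFF-PATH (not a consequence of
  `PercolationContinuityZ3`), lever = the exact exchange rate at every curve point (the K± germ); critic C.
-/

noncomputable section

namespace Summit.CriticalPhenomena.PercolationContinuityZ3.Cruxes.SubcritExchangeUniformity.FwdG6

open Summit.CriticalPhenomena.PercolationContinuityZ3.Theses.PercExchangeRateTransport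

/-- Graded family (index: a set `T` of horizontal densities): the floor `CriticalCurveRegular` AND, for every
`p ∈ T ∩ (0,1)` with `p < p₃ = p_c(ℤ³)`, `θ(p, p₃) = 0` (no percolation on the horizontal ledge left of the
isotropic point, at vertical density exactly `p_c(ℤ³)`).  `T = ∅` is literally the floor. -/
def LedgeNullLeft (T : Set ℝ) : Prop :=
  let μ := Literature.Probability.Percolation.labelMeasure (Literature.Probability.LatticeModels.Site 3); let vert : Sym2 (Literature.Probability.LatticeModels.Site 3) → Prop := fun e => ∃ x : Literature.Probability.LatticeModels.Site 3, e = s(x, x + Pi.single (2 : Fin 3) 1); let cfg : ℝ → ℝ → (Sym2 (Literature.Probability.LatticeModels.Site 3) → ℝ) → Set (Sym2 (Literature.Probability.LatticeModels.Site 3)) := fun p t U => {e | e ∈ (Literature.Probability.LatticeModels.zdGraph 3).edgeSet ∧ ((vert e ∧ U e ≤ t) ∨ (¬ vert e ∧ U e ≤ p))}; let θ : ℝ → ℝ → ℝ := fun p t => μ.real {U | cfg p t U ∈ Literature.Probability.Percolation.percolatesAt (0 : Literature.Probability.LatticeModels.Site 3)}; let pc : ℝ → ℝ := fun t => sInf ({p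 : ℝ | 0 ≤ p ∧ p ≤ 1 ∧ 0 < θ p t} ∪ {1}); (ContinuousOn pc (Set.Ioo 0 1) ∧ ∀ t ∈ Set.Ioo (0 : ℝ) 1, 0 < pc t ∧ pc t < 1) ∧ ∀ p ∈ T, p ∈ Set.Ioo (0 : ℝ) 1 → p < Literature.Probability.Percolation.criticalProb (Literature.Probability.LatticeModels.zdGraph 3) (0 : Literature.Probability.LatticeModels.Site 3) → θ p (Literature.Probability.Percolation.criticalProb (Literature.Probability.LatticeModels.zdGraph 3) (0 : Literature.Probability.LatticeModels.Site 3)) = 0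

/-- Candidate rung C1: the whole ledge, `T = univ`. -/
def IsoLedgeNull : Prop := LedgeNullLeft Set.univ

/-- F3: the floor is the member `T = ∅`. -/
theorem ledgeNullLeft_empty_iff : LedgeNullLeft ∅ ↔ CriticalCurveRegular := by
  unfold LedgeNullLeft CriticalCurveRegular
  simp

/-- The rung contains the floor. -/
theorem criticalCurveRegular_of_isoLedgeNull : IsoLedgeNull → CriticalCurveRegular := by
  unfold IsoLedgeNull LedgeNullLeft CriticalCurveRegular
  exact fun h => h.1

/-- F4 (on-path): `PercolationContinuityZ3 → IsoLedgeNull` — for `p < p₃`, `0 ≤ θ(p,p₃) ≤ θ(p₃,p₃) = θ_{ℤ³}(p_c) = 0`. -/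
theorem isoLedgeNull_of_percolationContinuityZ3 (hS : _root_.PercolationContinuityZ3) : IsoLedgeNull := by
  obtain ⟨-, -, -, -, -, -, -, -, h9, -⟩ :=
    Summit.CriticalPhenomena.PercolationContinuityZ3.Theorems.ModelFacts.modelFacts_proof
  delta IsoLedgeNull LedgeNullLeft
  intro μ vert cfg θ pc
  refine ⟨Summit.CriticalPhenomena.PercolationContinuityZ3.Cruxes.CriticalCurveRegular.Locmod.CriticalCurveRegular_proof, ?_⟩
  intro p _ _ hp
  have hmono : θ p (Literature.Probability.Percolation.criticalProb (Literature.Probability.LatticeModels.zdGraph 3)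
      (0 : Literature.Probability.LatticeModels.Site 3)) ≤
      θ (Literature.Probability.Percolation.criticalProb (Literature.Probability.LatticeModels.zdGraph 3)
      (0 : Literature.Probability.LatticeModels.Site 3))
      (Literature.Probability.Percolation.criticalProb (Literature.Probability.LatticeModels.zdGraph 3)
      (0 : Literature.Probability.LatticeModels.Site 3)) :=
    Summit.CriticalPhenomena.PercolationContinuityZ3.Cruxes.CriticalCurveRegular.Locmod.theta_mono hp.le le_rfl
  have hdiag : θ (Literature.Probability.Percolation.criticalProb (Literature.Probability.LatticeModels.zdGraph 3)
      (0 : Literature.Probability.LatticeModels.Site 3))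
      (Literature.Probability.Percolation.criticalProb (Literature.Probability.LatticeModels.zdGraph 3)
      (0 : Literature.Probability.LatticeModels.Site 3)) = 0 :=
    (h9 (Literature.Probability.Percolation.criticalProbI 3)).trans hS
  have hnn : 0 ≤ θ p (Literature.Probability.Percolation.criticalProb (Literature.Probability.LatticeModels.zdGraph 3)
      (0 : Literature.Probability.LatticeModels.Site 3)) := MeasureTheory.measureReal_nonneg
  exact le_antisymm (hmono.trans hdiag.le) hnn

/-- **FLATNESS CERTIFICATE.** The floor already implies the candidate: `CriticalCurveRegular → IsoLedgeNull`.
(i) for `0 ≤ t < p₃`, `t ≤ p_c(t)` (a density `p < t` gives `θ(p,t) ≤ θ(t,t) = θ_{ℤ³}(t) = 0`);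
(ii) continuity of `p_c` at `p₃ ∈ (0,1)` gives `p₃ ≤ p_c(p₃)`; (iii) threshold: `p < p_c(p₃)` forces `θ(p,p₃) = 0`. -/
theorem isoLedgeNull_of_floor (hF : CriticalCurveRegular) : IsoLedgeNull := by
  obtain ⟨-, -, -, -, -, -, -, -, h9, -⟩ :=
    Summit.CriticalPhenomena.PercolationContinuityZ3.Theorems.ModelFacts.modelFacts_proof
  have h3 := Literature.Probability.Percolation.Grimmett1999_criticalProb_pos_lt_one_holds 3 (by norm_num)
  delta IsoLedgeNull LedgeNullLeft
  delta CriticalCurveRegular at hF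
  intro μ vert cfg θ pc
  refine ⟨hF, ?_⟩
  set p₃ : ℝ := Literature.Probability.Percolation.criticalProb (Literature.Probability.LatticeModels.zdGraph 3)
      (0 : Literature.Probability.LatticeModels.Site 3) with hp₃
  intro p _ hp01 hp
  -- nonnegativity of θ and of the elements of the sInf-set
  have hθnn : ∀ q s, 0 ≤ θ q s := fun q s => MeasureTheory.measureReal_nonneg
  have hbdd : ∀ s, BddBelow ({q : ℝ | 0 ≤ q ∧ q ≤ 1 ∧ 0 < θ q s} ∪ {1}) := fun s =>
    ⟨0, by rintro q (⟨hq, -, -⟩ | hq) <;> simp_all⟩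
  have hne : ∀ s, ({q : ℝ | 0 ≤ q ∧ q ≤ 1 ∧ 0 < θ q s} ∪ {1}).Nonempty := fun s => ⟨1, Or.inr rfl⟩
  -- (i) t ≤ pc t for 0 ≤ t < p₃
  have hA : ∀ t, 0 ≤ t → t < p₃ → t ≤ pc t := by
    intro t ht0 htp
    have ht1 : t ≤ 1 := (htp.trans h3.2).le
    refine le_csInf (hne t) ?_
    rintro q (⟨hq0, hq1, hθq⟩ | hq)
    · by_contra hqt
      push Not at hqt
      have hle : θ q t ≤ θ t t :=
        Summit.CriticalPhenomena.PercolationContinuityZ3.Cruxes.CriticalCurveRegular.Locmod.theta_mono hqt.le le_rfl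
      have hzero : θ t t = 0 := by
        have e := h9 ⟨t, ht0, ht1⟩
        exact e.trans
          (Literature.Probability.Percolation.theta_eq_zero_of_lt_criticalProb_holds _ _ ⟨t, ht0, ht1⟩ htp)
      linarith
    · rw [Set.mem_singleton_iff] at hq
      rw [hq]; exact ht1
  -- (ii) p₃ ≤ pc p₃, by continuity of pc at p₃ within (0,1)
  have hB : p₃ ≤ pc p₃ := by
    by_contra hlt
    push Not at hlt
    have hcont : ContinuousWithinAt pc (Set.Ioo 0 1) p₃ := hF.1 p₃ ⟨h3.1, h3.2⟩
    rw [Metric.continuousWithinAt_iff] at hcont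
    set ε : ℝ := (p₃ - pc p₃) / 2 with hε
    have hεpos : 0 < ε := by rw [hε]; linarith
    obtain ⟨δ, hδ, hδε⟩ := hcont ε hεpos
    set δ' : ℝ := min (δ / 2) (min (p₃ / 2) ε) with hδ'
    have hδ'pos : 0 < δ' := by
      rw [hδ']; exact lt_min (by linarith) (lt_min (by linarith [h3.1]) hεpos)
    have hδ'1 : δ' ≤ δ / 2 := min_le_left _ _
    have hδ'2 : δ' ≤ p₃ / 2 := (min_le_right _ _).trans (min_le_left _ _)
    have hδ'3 : δ' ≤ ε := (min_le_right _ _).trans (min_le_right _ _)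
    set t : ℝ := p₃ - δ' with ht
    have ht0 : 0 < t := by rw [ht]; linarith [h3.1]
    have ht1 : t < 1 := by rw [ht]; linarith [h3.2]
    have htp : t < p₃ := by rw [ht]; linarith
    have hdist : dist t p₃ < δ := by
      rw [Real.dist_eq, ht, show p₃ - δ' - p₃ = -δ' by ring, abs_neg, abs_of_pos hδ'pos]
      linarith
    have hclose := hδε (x := t) ⟨ht0, ht1⟩ hdist
    rw [Real.dist_eq] at hclose
    have hup : pc t < pc p₃ + ε := by
      have := (abs_lt.mp hclose).2
      linarith
    have hlow : t ≤ pc t := hA t ht0.le htp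
    have : pc p₃ + ε = p₃ - ε := by rw [hε]; ring
    linarith
  -- (iii) threshold at the vertical density p₃
  have hpc : p < pc p₃ := hp.trans_le hB
  by_contra hne0
  have hpos : 0 < θ p p₃ := lt_of_le_of_ne (hθnn p p₃) (Ne.symm hne0)
  have hmem : p ∈ ({q : ℝ | 0 ≤ q ∧ q ≤ 1 ∧ 0 < θ q p₃} ∪ {1}) := Or.inl ⟨hp01.1.le, hp01.2.le, hpos⟩
  have hle : pc p₃ ≤ p := csInf_le (hbdd p₃) hmem
  linarith

/-- Hence the candidate is a theorem of the tree: FLAT (same rung as the floor), not filed. -/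
theorem isoLedgeNull_holds : IsoLedgeNull :=
  isoLedgeNull_of_floor
    Summit.CriticalPhenomena.PercolationContinuityZ3.Cruxes.CriticalCurveRegular.Locmod.CriticalCurveRegular_proof

/-- Graded family for candidate C2 (index: the smoothness class `r`): the critical curve is `C^r` on `(0,1)` and
stays inside the open square.  `r = 0` is the floor (`contDiffOn_zero`). -/
def CurveSmooth (r : WithTop ℕ∞) : Prop :=
  let μ := Literature.Probability.Percolation.labelMeasure (Literature.Probability.LatticeModels.Site 3); let vert : Sym2 (Literature.Probability.LatticeModels.Site 3) → Prop := fun e => ∃ x : Literature.Probability.LatticeModels.Site 3, e = s(x, x + Pi.single (2 : Fin 3) 1); let cfg : ℝ → ℝ → (Sym2 (Literature.Probability.LatticeModels.Site 3) → ℝ) → Set (Sym2 (Literature.Probability.LatticeModels.Site 3)) := fun p t U => {e | e ∈ (Literature.Probability.LatticeModels.zdGraph 3).edgeSet ∧ ((vert e ∧ U e ≤ t) ∨ (¬ vert e ∧ U e ≤ p))}; let θ : ℝ → ℝ → ℝ := fun p t => μ.real {U | cfg p t U ∈ Literature.Probability.Percolation.percolatesAt (0 : Literature.Probability.LatticeModels.Site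 3)}; let pc : ℝ → ℝ := fun t => sInf ({p : ℝ | 0 ≤ p ∧ p ≤ 1 ∧ 0 < θ p t} ∪ {1}); ContDiffOn ℝ r pc (Set.Ioo 0 1) ∧ ∀ t ∈ Set.Ioo (0 : ℝ) 1, 0 < pc t ∧ pc t < 1

/-- Candidate rung C2: `p_c ∈ C¹((0,1))` (Clausius–Clapeyron regularity of the anisotropic critical curve). -/
def CurveC1 : Prop := CurveSmooth 1

/-- F3: the floor is the member `r = 0`. -/
theorem curveSmooth_zero_iff : CurveSmooth 0 ↔ CriticalCurveRegular := by
  unfold CurveSmooth CriticalCurveRegular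
  simp only [contDiffOn_zero]

/-- The rung contains the floor (`C¹ ⇒ C⁰`). -/
theorem criticalCurveRegular_of_curveC1 : CurveC1 → CriticalCurveRegular := by
  unfold CurveC1 CurveSmooth CriticalCurveRegular
  exact fun h => ⟨h.1.continuousOn, h.2⟩

/-- F3 witness for C1: the floor's member `T = ∅`, closed by the seed. -/
example : LedgeNullLeft ∅ := by
  simpa [ledgeNullLeft_empty_iff] using
    Summit.CriticalPhenomena.PercolationContinuityZ3.Cruxes.CriticalCurveRegular.Locmod.CriticalCurveRegular_proof

/-- F3 witness for C2: the floor's member `r = 0`, closed by the seed. -/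
example : CurveSmooth 0 := by
  simpa [curveSmooth_zero_iff] using
    Summit.CriticalPhenomena.PercolationContinuityZ3.Cruxes.CriticalCurveRegular.Locmod.CriticalCurveRegular_proof

/-- Order check for C2: `S`, the floor and `CurveC1` — only `CurveC1 → floor` is available; `S → CurveC1` is NOT
claimed (off-path: `θ_{ℤ³}(p_c) = 0` says nothing about the differentiability of `p_c(·)`). -/
theorem curveC1_order : (CurveC1 → CriticalCurveRegular) ∧ (IsoLedgeNull → CriticalCurveRegular) :=
  ⟨criticalCurveRegular_of_curveC1, criticalCurveRegular_of_isoLedgeNull⟩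

end Summit.CriticalPhenomena.PercolationContinuityZ3.Cruxes.SubcritExchangeUniformity.FwdG6

end
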